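import Summits.BirchSwinnertonDyer.BirchSwinnertonDyer.Theorems.EisensteinPrimesWeakLeopoldtAboveCharModule
import Summits.BirchSwinnertonDyer.BirchSwinnertonDyer.Theorems.EisensteinPrimesWeakLeopoldtAboveCurve
import Literature.NumberTheory.GaloisCohomology.RestrictedRamificationCdTwoOfPoitouTate
import HarnessLib

/-!
# WL_ω / WL_f / WL_1 in the crux's binders with the `cd`-input read from Poitou–Tate Thm. 17.13 (a) instead of Cor. 17.14
# (cell `bsd-eis`, seat `bsd-line-x1-p1-w2` gen 4; crux 2 `GoodLatticeBDPValue` stmt-BirchSwinnertonDyer-19032, line `halves` v20.1,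
# V21 road input WL_A — the CD2 atom of OBJECTION #2)

HONEST FRAMING (cell `bsd-eis`, run/shared/lean/pub/bsd-eis/): theorems only (no definition, no named fact, no `sorry`, no `Theses`
import); PUBLISHED facts enter as hypotheses by name; BSD / IMC2 / KY Thm. 1.4.1 are proved for NO curve here. Helper
`--supports stmt-BirchSwinnertonDyer-19032`; closes no registered stub.

## What

The registered skeleton `halves` v20.1 (a012386a…) feeds `stub_indexInputs` nine PUB facts but NOT `cd_p(G_{K,Σ}) ≤ 2`, which the
`H²`-bookkeeping conjunct consumes (w4 g4's `natCard_H2bookkeeping_unramifiedOutside_kerSubgroup`, and the three WL inputs = this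
seat's `…WeakLeopoldtAboveCharModule` / `…WeakLeopoldtAboveCurve`) — OBJECTION #2 (w5 g0, STATUS 16:40:59Z). The tree offers TWO
published atoms for that input: Harari Cor. 17.14 (`GaloisCohomology.groupCdLE_two_galoisGroupUnramifiedOutside K`, the `hCD2` of
this seat's files) and Harari Thm. 17.13 (a) (`GaloisCohomology.poitouTate_restricted_three_le K`), from which the tree DERIVES
Cor. 17.14 for totally complex `K` (`groupCdLE_two_galoisGroupUnramifiedOutside_of_poitouTate`). THIS FILE restates the two crux-binder
WL theorems with the `cd`-input in the 17.13 (a) spelling (`K` imaginary quadratic is totally complex), so that the LEAD's reshape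
v20.2 may add EITHER atom to `stub_publishedFactsGreenberg` / `…More`:

* `subsingleton_H_two_above_charModule_of_poitouTate` — WL_ω / WL_1 (θ ∈ {θsub, θquot}, [RH] at `Sf = ∅`).
* `subsingleton_H_two_above_geomPrimaryTorsion_of_poitouTate` — WL_f (`hSsub`, `hSquot`).

References: [Harari2020] Thm. 17.13 (a), Cor. 17.14 (p. 295); [NeukirchSchmidtWingberg2008] (8.3.18), (8.6.10) (ii);
[Greenberg2006] Thm. 3, Props. 3.2, 4.1–4.2, §5 A; [KellerYin2024] §1.4; the road memo §3.
-/

set_option autoImplicit false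
set_option linter.dupNamespace false -- the summit namespace `…BirchSwinnertonDyer.BirchSwinnertonDyer.Theorems` (Sub = Summit, D-0017) trips it

noncomputable section

open scoped Classical
open NumberField IsDedekindDomain Field WeierstrassCurve
open Literature.NumberTheory.EllipticCurves Literature.NumberTheory.EllipticCurves.GreenbergSelmer
  Literature.NumberTheory.EllipticCurves.GreenbergVatsal2000 Literature.NumberTheory.GaloisRepresentations
  Literature.NumberTheory.GaloisCohomology
  Literature.NumberTheory.EllipticCurves.KellerYin2024 Literature.NumberTheory.EllipticCurves.IwasawaDual
  Literature.NumberTheory.EllipticCurves.Castella2018.AcSelmer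
  Literature.NumberTheory.IwasawaTheory Literature.NumberTheory.IwasawaTheory.Greenberg2016
  Literature.NumberTheory.IwasawaTheory.Greenberg2006
  Summit.BirchSwinnertonDyer.BirchSwinnertonDyer.Theorems.WeakLeopoldtAboveCharModule
  Summit.BirchSwinnertonDyer.BirchSwinnertonDyer.Theorems.WeakLeopoldtAboveCurve

namespace Summit.BirchSwinnertonDyer.BirchSwinnertonDyer.Theorems.WeakLeopoldtAboveOfPoitouTate

variable {K : Type} [Field K] [NumberField K] {p : ℕ} [Fact p.Prime]

/-- `cd_p(G_{K,Σ}) ≤ 2` for an IMAGINARY QUADRATIC `K` from Poitou–Tate Thm. 17.13 (a) (the product over the real places is empty).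
[cite: Harari2020, Thm. 17.13 (a) and Cor. 17.14 (p. 295)] [cite: NeukirchSchmidtWingberg2008, (8.3.18)] -/
theorem groupCdLE_two_of_poitouTate_of_isImaginaryQuadratic (hK : IsImaginaryQuadratic K)
    (ha : poitouTate_restricted_three_le K) : groupCdLE_two_galoisGroupUnramifiedOutside K := by
  haveI := hK.2
  exact groupCdLE_two_galoisGroupUnramifiedOutside_of_poitouTate ha

/-- **WL_ω / WL_1 in the crux's binders, `cd`-input = Poitou–Tate Thm. 17.13 (a).** Same statement as
`WeakLeopoldtAboveCharModule.subsingleton_H_two_above_charModule_of_RH` with `hCD2` replaced by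
`ha : poitouTate_restricted_three_le K`. [cite: Harari2020, Thm. 17.13 (a), Cor. 17.14]
[cite: Greenberg2006, Thm. 3 p. 342, Props. 4.1–4.2, §5 A, 3.2] [cite: KellerYin2024, Thm. 1.2.2, §1.4] -/
theorem subsingleton_H_two_above_charModule_of_poitouTate (ha : poitouTate_restricted_three_le K)
    (h41 : prop41_globalEulerPoincareCorank) (h42 : prop42_localEulerPoincareCorank)
    (h5A : sec5A_localH2_subsingleton_of_LOC1) (h32 : prop32_cohomology_isCofinitelyGenerated)
    (W : WeierstrassCurve ℚ) [W.IsElliptic] (hp : 2 < p) (hK : IsImaginaryQuadratic K)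
    (hH : SatisfiesHeegnerHypothesis (W.conductorNorm ℤ) K)
    {ι : K →+* ℚ_[p]} {v vbar : HeightOneSpectrum (𝓞 K)}
    (hvι : ∀ x : 𝓞 K, x ∈ v.asIdeal ↔ ‖ι (x : K)‖ < 1)
    (hvbar : ((p : ℕ) : 𝓞 K) ∈ vbar.asIdeal) (hne : vbar ≠ v)
    (κ : ZpExtension K p) (hκ : κ.IsAnticyclotomic) (γ : absoluteGaloisGroup K) [Fact (κ.IsTopGenerator γ)]
    {θsub θquot : FramedGaloisRep K (padicCoeffIntegers (∅ : Set (PadicAlgCl p))) 1}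
    (hpair : IsResidualPairOver (W.baseChange K) p θsub θquot)
    (Sf : Finset (HeightOneSpectrum (𝓞 K)))
    (hSf : ∀ w : HeightOneSpectrum (𝓞 K), w ∈ Sf ↔ ((W.conductorNorm ℤ : ℤ) : 𝓞 K) ∈ w.asIdeal)
    (θ : FramedGaloisRep K (padicCoeffIntegers (∅ : Set (PadicAlgCl p))) 1) (hθ : θ = θsub ∨ θ = θquot)
    (hRH : ∀ D : DatumDualData κ γ (charModule (∅ : Set (PadicAlgCl p)) θ)
        (bdpData (charModule (∅ : Set (PadicAlgCl p)) θ) p vbar) (∅ : Set (HeightOneSpectrum (𝓞 K))),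
      Module.Finite (IwasawaAlgebra p) D.X ∧ Module.IsTorsion (IwasawaAlgebra p) D.X ∧ muInvariant p D.X = 0)
    [TopologicalSpace (charModule (∅ : Set (PadicAlgCl p)) θ)] [DiscreteTopology (charModule (∅ : Set (PadicAlgCl p)) θ)]
    {R : Type} [CommRing R] [TopologicalSpace R] [Module R (charModule (∅ : Set (PadicAlgCl p)) θ)]
    [ContinuousSMul R (charModule (∅ : Set (PadicAlgCl p)) θ)]
    (ρM : ContinuousRep (GaloisGroupUnramifiedOutside K (↑(insert v (insert vbar Sf)) : Set (HeightOneSpectrum (𝓞 K))))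
      R (charModule (∅ : Set (PadicAlgCl p)) θ))
    (hρM : ∀ (σ : absoluteGaloisGroup K) (m : charModule (∅ : Set (PadicAlgCl p)) θ),
      ρM (toUnramifiedQuot K _ σ) m = σ • m) :
    Subsingleton ((ρM.restrict
      (galoisGroupAboveSubtype (↑(insert v (insert vbar Sf)) : Set (HeightOneSpectrum (𝓞 K))) κ.kerSubgroup)).H 2) :=
  subsingleton_H_two_above_charModule_of_RH (groupCdLE_two_of_poitouTate_of_isImaginaryQuadratic hK ha) h41 h42 h5A h32 W hp
    hK hH hvι hvbar hne κ hκ γ hpair Sf hSf θ hθ hRH ρM hρM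

/-- **WL_f in the crux's binders, `cd`-input = Poitou–Tate Thm. 17.13 (a).** Same statement as
`WeakLeopoldtAboveCurve.subsingleton_H_two_above_geomPrimaryTorsion` with `hCD2` replaced by `ha : poitouTate_restricted_three_le K`.
[cite: Harari2020, Thm. 17.13 (a), Cor. 17.14] [cite: Greenberg2006, Thm. 3 p. 342, Props. 4.1–4.2, §5 A, 3.2]
[cite: Castella2018, §2.2 Def. 2.2] [cite: KellerYin2024, Thm. 1.4.1, §1.4] -/
theorem subsingleton_H_two_above_geomPrimaryTorsion_of_poitouTate (ha : poitouTate_restricted_three_le K)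
    (h41 : prop41_globalEulerPoincareCorank) (h42 : prop42_localEulerPoincareCorank)
    (h5A : sec5A_localH2_subsingleton_of_LOC1) (h32 : prop32_cohomology_isCofinitelyGenerated)
    (W : WeierstrassCurve ℚ) [W.IsElliptic] (hp : 2 < p) (hK : IsImaginaryQuadratic K)
    (hH : SatisfiesHeegnerHypothesis (W.conductorNorm ℤ) K)
    {ι : K →+* ℚ_[p]} {v vbar : HeightOneSpectrum (𝓞 K)}
    (hvι : ∀ x : 𝓞 K, x ∈ v.asIdeal ↔ ‖ι (x : K)‖ < 1)
    (hvbar : ((p : ℕ) : 𝓞 K) ∈ vbar.asIdeal) (hne : vbar ≠ v)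
    (κ : ZpExtension K p) (hκ : κ.IsAnticyclotomic) (γ : absoluteGaloisGroup K) [Fact (κ.IsTopGenerator γ)]
    {θsub θquot : FramedGaloisRep K (padicCoeffIntegers (∅ : Set (PadicAlgCl p))) 1}
    (hpair : IsResidualPairOver (W.baseChange K) p θsub θquot)
    (Sf : Finset (HeightOneSpectrum (𝓞 K)))
    (hSf : ∀ w : HeightOneSpectrum (𝓞 K), w ∈ Sf ↔ ((W.conductorNorm ℤ : ℤ) : 𝓞 K) ∈ w.asIdeal)
    (hSsub : ∀ D : DatumDualData κ γ (charModule (∅ : Set (PadicAlgCl p)) θsub)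
      (bdpData (charModule (∅ : Set (PadicAlgCl p)) θsub) p vbar) (↑Sf : Set (HeightOneSpectrum (𝓞 K))),
      Module.Finite (IwasawaAlgebra p) D.X ∧ Module.IsTorsion (IwasawaAlgebra p) D.X ∧ muInvariant p D.X = 0)
    (hSquot : ∀ D : DatumDualData κ γ (charModule (∅ : Set (PadicAlgCl p)) θquot)
      (bdpData (charModule (∅ : Set (PadicAlgCl p)) θquot) p vbar) (↑Sf : Set (HeightOneSpectrum (𝓞 K))),
      Module.Finite (IwasawaAlgebra p) D.X ∧ Module.IsTorsion (IwasawaAlgebra p) D.X ∧ muInvariant p D.X = 0)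
    {R : Type} [CommRing R] [TopologicalSpace R] [Module R ↥((W.baseChange K).geomPrimaryTorsion p)]
    [ContinuousSMul R ↥((W.baseChange K).geomPrimaryTorsion p)]
    (ρM : ContinuousRep (GaloisGroupUnramifiedOutside K (↑(insert v (insert vbar Sf)) : Set (HeightOneSpectrum (𝓞 K))))
      R ↥((W.baseChange K).geomPrimaryTorsion p))
    (hρM : ∀ (σ : absoluteGaloisGroup K) (P : ↥((W.baseChange K).geomPrimaryTorsion p)),
      ρM (toUnramifiedQuot K _ σ) P = σ • P) :
    Subsingleton ((ρM.restrict
      (galoisGroupAboveSubtype (↑(insert v (insert vbar Sf)) : Set (HeightOneSpectrum (𝓞 K))) κ.kerSubgroup)).H 2) :=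
  subsingleton_H_two_above_geomPrimaryTorsion (groupCdLE_two_of_poitouTate_of_isImaginaryQuadratic hK ha) h41 h42 h5A h32 W hp
    hK hH hvι hvbar hne κ hκ γ hpair Sf hSf hSsub hSquot ρM hρM

end Summit.BirchSwinnertonDyer.BirchSwinnertonDyer.Theorems.WeakLeopoldtAboveOfPoitouTate

end
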